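import Summits.HodgeConjecture.HodgeConjecture.Theorems.Ring2WeilCoverageWeilGramLevel20
import HarnessLib

/-!
# Weil-type family coverage — THE COMPONENTS OF THE WEIL-TYPE `ℤ[ζ₂₀]`-FOURFOLDS, II: `K_d = ℚ(√−5)`
# (`s₅ = ζ⁵(1 + 2(ζ⁴ + ζ¹⁶)) = i√5`, `s₅² = −5`): the principal-type form has Gram determinant `400 = 20²` — SPLIT, right
# sign: every principally polarised Weil-type `ℤ[ζ₂₀]`-fourfold for `ℚ(√−5)` lies on row W4.5.1

research route conditional on HC_CM; not a corollary; Q11.4-sentence-2 already refuted in dim ≥ 3.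

Ring 2, WEIL-TYPE FAMILY-COVERAGE CENSUS (`HOME/WEIL-FAMILY-COVERAGE.md` `## b01`, block b01.46 (C2)), part 88 of the
`Ring2WeilCoverage*` series; continues part 87 (frame `θ^i`, `ξ = ζ³/Φ₂₀′(ζ)`).

* §0 `r₅ = 1 + 2(ζ⁴ + ζ¹⁶)` (`= √5`, the Gauss sum of `ℚ(ζ₅) ⊂ ℚ(ζ₂₀)`) is real with `r₅² = 5`; `s₅ = ζ⁵ r₅` is skew with
  `s₅² = −5`: `ℚ(s₅) = ℚ(√−5) ⊂ K`, the second imaginary quadratic subfield.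
* §1 the traces `Tr(ξ s₅ θ^m)` and the Gram datum: **`a = −(0,2,0,10 / 2,0,10,0 / 0,10,0,40 / 10,0,40,0)`,
  `det a = 400`**; §2 **EVERY skew `ζ′` of principal type gives `400`** (THEOREM L (i) at `20`); such `Φ`-positive `ζ′`
  exist on every `ℚ(√−5)`-balanced `Φ` (part 75 `exists_principal_twenty_sqrt_neg_five`); class **`[400] = [1]` =
  SPLIT** in `ℚˣ/Nm(ℚ(√−5)ˣ)`, right sign — row W4.5.1.

HONEST FRAMING as parts 82–87; `HC_CM` is used nowhere.  No `def`, no named fact, no `sorry`.  Certificates from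
`work/py/gen20.py`, re-verified by `linear_combination`.

References: [cite: vanGeemen1994HodgeAV, Lemma 5.2 (2)–(4), 5.4 and (5.4.1)]; [cite: Shimura1998, §14.3 Prop. 4–5,
pp. 103–104]; census b01.46 (C2) (seat-derived).
-/

noncomputable section

open Polynomial NumberField Module
open scoped nonZeroDivisors

namespace Summit.HodgeConjecture.Ring2WeilCoverage.WeilGramLevel20SqrtNegFive

open Literature.AlgebraicGeometry.VanGeemen1994 (weilField weilNormResidueGroup)
open Literature.AlgebraicGeometry.Motives (normUnitsSubgroup)
open Literature.NumberTheory.ComplexMultiplication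
open Summit.HodgeConjecture.Ring2WeilCoverage.TraceGramDeterminant (trace_aeval_zeta_mul_inv)
open Summit.HodgeConjecture.Ring2WeilCoverage.WeilGramCMPoint
open Summit.HodgeConjecture.Ring2WeilCoverage.RealUnitNormHalfSystems (complexConj_eq_inv)
open Summit.HodgeConjecture.Ring2WeilCoverage.CyclotomicPrincipalObstruction (complexConj_xi)
open Summit.HodgeConjecture.Ring2WeilCoverage.CyclotomicDifferent (isOfType_one_xi_top xi_ne_zero)
open Summit.HodgeConjecture.Ring2WeilCoverage.RealUnitNormAllLevels (norm_realUnits_pos_twenty)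
open Summit.HodgeConjecture.HodgeConjecture.Ring2.WeilCoverage (mk_eq_split_of_even mem_normUnitsSubgroup_of_sq_add_mul_sq)
open Summit.HodgeConjecture.HodgeConjecture.Ring2.Hypotheses (splitDiscriminantClass)
open Summit.HodgeConjecture.Ring2WeilCoverage.WeilGramLevel20
variable {K : Type} [Field K] [NumberField K] {ζ : K}

/-! ### §0 `s₅ = ζ⁵·r₅`, `r₅ = 1 + 2(ζ⁴ + ζ¹⁶) = √5` -/

/-- `r₅ = 1 + 2(ζ⁴ + ζ¹⁶)` is real. [folklore] -/
theorem complexConj_sqrtFive [IsCMField K] (hζ : IsPrimitiveRoot ζ 20) :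
    IsCMField.complexConj K (1 + 2 * (ζ ^ 4 + ζ ^ 16)) = 1 + 2 * (ζ ^ 4 + ζ ^ 16) := by
  rw [map_add, map_mul, map_add, map_pow, map_pow, complexConj_eq_inv hζ, map_one, map_ofNat,
    inv_pow_eq_pow hζ (show 4 + 16 = 20 by norm_num), inv_pow_eq_pow hζ (show 16 + 4 = 20 by norm_num), add_comm (ζ ^ 16)]

omit [NumberField K] in
/-- `r₅² = 5`. [folklore] -/
theorem sq_sqrtFive (hζ : IsPrimitiveRoot ζ 20) : (1 + 2 * (ζ ^ 4 + ζ ^ 16)) ^ 2 = 5 := by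
  have h20 : ζ ^ 20 = 1 := hζ.pow_eq_one
  linear_combination (4 + 4 * ζ ^ 2 + 4 * ζ ^ 4 + 4 * ζ ^ 6 + 4 * ζ ^ 8) * cyc_twenty hζ + (8 + 4 * ζ ^ 12) * h20

omit [NumberField K] in
/-- **`s₅² = −5`** for `s₅ = ζ⁵(1 + 2(ζ⁴ + ζ¹⁶))`. [folklore] -/
theorem sq_sqrtNegFive (hζ : IsPrimitiveRoot ζ 20) : (ζ ^ 5 * (1 + 2 * (ζ ^ 4 + ζ ^ 16))) ^ 2 = -5 := by
  rw [mul_pow, sq_sqrtNegOne hζ, sq_sqrtFive hζ]; norm_num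

/-- **`s₅` is skew.** [folklore] -/
theorem complexConj_sqrtNegFive [IsCMField K] (hζ : IsPrimitiveRoot ζ 20) :
    IsCMField.complexConj K (ζ ^ 5 * (1 + 2 * (ζ ^ 4 + ζ ^ 16))) = -(ζ ^ 5 * (1 + 2 * (ζ ^ 4 + ζ ^ 16))) := by
  rw [map_mul, complexConj_sqrtNegOne hζ, complexConj_sqrtFive hζ, neg_mul]

/-! ### §1 The principal-type form `E_ξ` for `K_d = ℚ(√−5)`: `det = 400` -/

/-- `Tr(ζ′sθ^0) = 0` for `ζ′ = ξ = ζ³/Φ′(ζ)`, `s = √−5 = ζ⁵(1 + 2(ζ⁴ + ζ¹⁶))`, `θ = ζ + ζ⁻¹` (Euler evaluation). research route conditional on HC_CM; not a corollary; Q11.4-sentence-2 already refuted in dim ≥ 3. [folklore] -/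
theorem trace_xi_sqrtNegFive_zero [IsCyclotomicExtension {20} ℚ K] (hζ : IsPrimitiveRoot ζ 20) :
    Algebra.trace ℚ K ((ζ ^ 3 * (aeval ζ (derivative (cyclotomic 20 ℚ)))⁻¹) * (ζ ^ 5 * (1 + 2 * (ζ ^ 4 + ζ ^ 16)))) = 0 := by
  have h20 : ζ ^ 20 = 1 := hζ.pow_eq_one
  have hΦ := cyc_twenty hζ
  rw [trace_of_key₀ hζ (C (-1 : ℚ) + C (0 : ℚ) * X + C (-1 : ℚ) * X ^ 2 + C (0 : ℚ) * X ^ 3 + C (1 : ℚ) * X ^ 4 +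
      C (0 : ℚ) * X ^ 5 + C (1 : ℚ) * X ^ 6 + C (0 : ℚ) * X ^ 7) (by compute_degree) (by
    rw [aeval_poly₈]
    push_cast
    linear_combination ((aeval ζ (derivative (cyclotomic 20 ℚ)))⁻¹ * (1 + 2 * ζ^2 + 2 * ζ^4)) * hΦ +
      ((aeval ζ (derivative (cyclotomic 20 ℚ)))⁻¹ * (2 * ζ^4)) * h20)]
  norm_num [coeff_X_pow, coeff_X, coeff_C, coeff_one]

/-- `Tr(ζ′sθ^1) = 2` for `ζ′ = ξ = ζ³/Φ′(ζ)`, `s = √−5 = ζ⁵(1 + 2(ζ⁴ + ζ¹⁶))`, `θ = ζ + ζ⁻¹` (Euler evaluation). research route conditional on HC_CM; not a corollary; Q11.4-sentence-2 already refuted in dim ≥ 3. [folklore] -/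
theorem trace_xi_sqrtNegFive_one [IsCyclotomicExtension {20} ℚ K] (hζ : IsPrimitiveRoot ζ 20) :
    Algebra.trace ℚ K ((ζ ^ 3 * (aeval ζ (derivative (cyclotomic 20 ℚ)))⁻¹) * (ζ ^ 5 * (1 + 2 * (ζ ^ 4 + ζ ^ 16))) * (ζ + ζ⁻¹)) = 2 := by
  have h20 : ζ ^ 20 = 1 := hζ.pow_eq_one
  have hΦ := cyc_twenty hζ
  rw [trace_of_key₁ hζ (C (0 : ℚ) + C (-3 : ℚ) * X + C (0 : ℚ) * X ^ 2 + C (1 : ℚ) * X ^ 3 + C (0 : ℚ) * X ^ 4 + C (1 : ℚ) * X ^ 5 +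
      C (0 : ℚ) * X ^ 6 + C (2 : ℚ) * X ^ 7) (by compute_degree) (by
    rw [aeval_poly₈]
    push_cast
    linear_combination ((aeval ζ (derivative (cyclotomic 20 ℚ)))⁻¹ * (3 * ζ^2 + 4 * ζ^4 + 2 * ζ^6)) * hΦ +
      ((aeval ζ (derivative (cyclotomic 20 ℚ)))⁻¹ * (2 * ζ^4 + 2 * ζ^6)) * h20)]
  norm_num [coeff_X_pow, coeff_X, coeff_C, coeff_one]

/-- `Tr(ζ′sθ^2) = 0` for `ζ′ = ξ = ζ³/Φ′(ζ)`, `s = √−5 = ζ⁵(1 + 2(ζ⁴ + ζ¹⁶))`, `θ = ζ + ζ⁻¹` (Euler evaluation). research route conditional on HC_CM; not a corollary; Q11.4-sentence-2 already refuted in dim ≥ 3. [folklore] -/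
theorem trace_xi_sqrtNegFive_two [IsCyclotomicExtension {20} ℚ K] (hζ : IsPrimitiveRoot ζ 20) :
    Algebra.trace ℚ K ((ζ ^ 3 * (aeval ζ (derivative (cyclotomic 20 ℚ)))⁻¹) * (ζ ^ 5 * (1 + 2 * (ζ ^ 4 + ζ ^ 16))) * (ζ + ζ⁻¹) ^ 2) = 0 := by
  have h20 : ζ ^ 20 = 1 := hζ.pow_eq_one
  have hΦ := cyc_twenty hζ
  rw [trace_of_key hζ (C (-5 : ℚ) + C (0 : ℚ) * X + C (0 : ℚ) * X ^ 2 + C (0 : ℚ) * X ^ 3 + C (0 : ℚ) * X ^ 4 + C (0 : ℚ) * X ^ 5 +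
      C (5 : ℚ) * X ^ 6 + C (0 : ℚ) * X ^ 7) (by compute_degree) (by
    rw [aeval_poly₈]
    push_cast
    linear_combination ((aeval ζ (derivative (cyclotomic 20 ℚ)))⁻¹ * (5 * ζ^2 + 7 * ζ^4 + 6 * ζ^6 + 2 * ζ^8)) * hΦ +
      ((aeval ζ (derivative (cyclotomic 20 ℚ)))⁻¹ * (2 * ζ^4 + 4 * ζ^6 + 2 * ζ^8)) * h20)]
  norm_num [coeff_X_pow, coeff_X, coeff_C, coeff_one]

/-- `Tr(ζ′sθ^3) = 10` for `ζ′ = ξ = ζ³/Φ′(ζ)`, `s = √−5 = ζ⁵(1 + 2(ζ⁴ + ζ¹⁶))`, `θ = ζ + ζ⁻¹` (Euler evaluation). research route conditional on HC_CM; not a corollary; Q11.4-sentence-2 already refuted in dim ≥ 3. [folklore] -/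
theorem trace_xi_sqrtNegFive_three [IsCyclotomicExtension {20} ℚ K] (hζ : IsPrimitiveRoot ζ 20) :
    Algebra.trace ℚ K ((ζ ^ 3 * (aeval ζ (derivative (cyclotomic 20 ℚ)))⁻¹) * (ζ ^ 5 * (1 + 2 * (ζ ^ 4 + ζ ^ 16))) * (ζ + ζ⁻¹) ^ 3) = 10 := by
  have h20 : ζ ^ 20 = 1 := hζ.pow_eq_one
  have hΦ := cyc_twenty hζ
  rw [trace_of_key hζ (C (0 : ℚ) + C (-10 : ℚ) * X + C (0 : ℚ) * X ^ 2 + C (5 : ℚ) * X ^ 3 + C (0 : ℚ) * X ^ 4 +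
      C (0 : ℚ) * X ^ 5 + C (0 : ℚ) * X ^ 6 + C (10 : ℚ) * X ^ 7) (by compute_degree) (by
    rw [aeval_poly₈]
    push_cast
    linear_combination ((aeval ζ (derivative (cyclotomic 20 ℚ)))⁻¹ * (12 * ζ^4 + 13 * ζ^6 + 8 * ζ^8 + 2 * ζ^10)) * hΦ +
      ((aeval ζ (derivative (cyclotomic 20 ℚ)))⁻¹ * (2 * ζ^4 + 6 * ζ^6 + 6 * ζ^8 + 2 * ζ^10)) * h20)]
  norm_num [coeff_X_pow, coeff_X, coeff_C, coeff_one]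

/-- `Tr(ζ′sθ^4) = 0` for `ζ′ = ξ = ζ³/Φ′(ζ)`, `s = √−5 = ζ⁵(1 + 2(ζ⁴ + ζ¹⁶))`, `θ = ζ + ζ⁻¹` (Euler evaluation). research route conditional on HC_CM; not a corollary; Q11.4-sentence-2 already refuted in dim ≥ 3. [folklore] -/
theorem trace_xi_sqrtNegFive_four [IsCyclotomicExtension {20} ℚ K] (hζ : IsPrimitiveRoot ζ 20) :
    Algebra.trace ℚ K ((ζ ^ 3 * (aeval ζ (derivative (cyclotomic 20 ℚ)))⁻¹) * (ζ ^ 5 * (1 + 2 * (ζ ^ 4 + ζ ^ 16))) * (ζ + ζ⁻¹) ^ 4) = 0 := by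
  have h20 : ζ ^ 20 = 1 := hζ.pow_eq_one
  have hΦ := cyc_twenty hζ
  rw [trace_of_key hζ (C (-20 : ℚ) + C (0 : ℚ) * X + C (5 : ℚ) * X ^ 2 + C (0 : ℚ) * X ^ 3 + C (-5 : ℚ) * X ^ 4 +
      C (0 : ℚ) * X ^ 5 + C (20 : ℚ) * X ^ 6 + C (0 : ℚ) * X ^ 7) (by compute_degree) (by
    rw [aeval_poly₈]
    push_cast
    linear_combination ((aeval ζ (derivative (cyclotomic 20 ℚ)))⁻¹ * (2 + 2 * ζ^2 + 22 * ζ^4 + 25 * ζ^6 + 21 * ζ^8 +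
        8 * ζ^10)) * hΦ +
      ((aeval ζ (derivative (cyclotomic 20 ℚ)))⁻¹ * (2 + 2 * ζ^4 + 8 * ζ^6 + 12 * ζ^8 + 8 * ζ^10 +
        2 * ζ^12)) * h20)]
  norm_num [coeff_X_pow, coeff_X, coeff_C, coeff_one]

/-- `Tr(ζ′sθ^5) = 40` for `ζ′ = ξ = ζ³/Φ′(ζ)`, `s = √−5 = ζ⁵(1 + 2(ζ⁴ + ζ¹⁶))`, `θ = ζ + ζ⁻¹` (Euler evaluation). research route conditional on HC_CM; not a corollary; Q11.4-sentence-2 already refuted in dim ≥ 3. [folklore] -/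
theorem trace_xi_sqrtNegFive_five [IsCyclotomicExtension {20} ℚ K] (hζ : IsPrimitiveRoot ζ 20) :
    Algebra.trace ℚ K ((ζ ^ 3 * (aeval ζ (derivative (cyclotomic 20 ℚ)))⁻¹) * (ζ ^ 5 * (1 + 2 * (ζ ^ 4 + ζ ^ 16))) * (ζ + ζ⁻¹) ^ 5) = 40 := by
  have h20 : ζ ^ 20 = 1 := hζ.pow_eq_one
  have hΦ := cyc_twenty hζ
  rw [trace_of_key hζ (C (0 : ℚ) + C (-35 : ℚ) * X + C (0 : ℚ) * X ^ 2 + C (20 : ℚ) * X ^ 3 + C (0 : ℚ) * X ^ 4 +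
      C (-5 : ℚ) * X ^ 5 + C (0 : ℚ) * X ^ 6 + C (40 : ℚ) * X ^ 7) (by compute_degree) (by
    rw [aeval_poly₈]
    push_cast
    linear_combination ((aeval ζ (derivative (cyclotomic 20 ℚ)))⁻¹ * (10 + 12 * ζ^2 + 4 * ζ^4 + 47 * ζ^6 + 46 * ζ^8 +
        21 * ζ^10)) * hΦ +
      ((aeval ζ (derivative (cyclotomic 20 ℚ)))⁻¹ * (10 + 2 * ζ^2 + 2 * ζ^4 + 10 * ζ^6 + 20 * ζ^8 + 20 * ζ^10 +
        10 * ζ^12 + 2 * ζ^14)) * h20)]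
  norm_num [coeff_X_pow, coeff_X, coeff_C, coeff_one]

/-- `Tr(ζ′sθ^6) = 0` for `ζ′ = ξ = ζ³/Φ′(ζ)`, `s = √−5 = ζ⁵(1 + 2(ζ⁴ + ζ¹⁶))`, `θ = ζ + ζ⁻¹` (Euler evaluation). research route conditional on HC_CM; not a corollary; Q11.4-sentence-2 already refuted in dim ≥ 3. [folklore] -/
theorem trace_xi_sqrtNegFive_six [IsCyclotomicExtension {20} ℚ K] (hζ : IsPrimitiveRoot ζ 20) :
    Algebra.trace ℚ K ((ζ ^ 3 * (aeval ζ (derivative (cyclotomic 20 ℚ)))⁻¹) * (ζ ^ 5 * (1 + 2 * (ζ ^ 4 + ζ ^ 16))) * (ζ + ζ⁻¹) ^ 6) = 0 := by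
  have h20 : ζ ^ 20 = 1 := hζ.pow_eq_one
  have hΦ := cyc_twenty hζ
  rw [trace_of_key hζ (C (-75 : ℚ) + C (0 : ℚ) * X + C (25 : ℚ) * X ^ 2 + C (0 : ℚ) * X ^ 3 + C (-25 : ℚ) * X ^ 4 +
      C (0 : ℚ) * X ^ 5 + C (75 : ℚ) * X ^ 6 + C (0 : ℚ) * X ^ 7) (by compute_degree) (by
    rw [aeval_poly₈]
    push_cast
    linear_combination ((aeval ζ (derivative (cyclotomic 20 ℚ)))⁻¹ * (31 + 43 * ζ^2 + 16 * ζ^4 + 91 * ζ^6 + 93 * ζ^8 +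
        46 * ζ^10)) * hΦ +
      ((aeval ζ (derivative (cyclotomic 20 ℚ)))⁻¹ * (31 + 12 * ζ^2 + 4 * ζ^4 + 12 * ζ^6 + 30 * ζ^8 + 40 * ζ^10 +
        30 * ζ^12 + 12 * ζ^14 + 2 * ζ^16)) * h20)]
  norm_num [coeff_X_pow, coeff_X, coeff_C, coeff_one]

/-- **The Gram datum `a` of `(E_ζ′, s)` in the real frame `θ^i` (`i < 4`)** for `ζ′ = ξ = ζ³/Φ′(ζ)` (principal type (1)),
`s = √−5 = ζ⁵(1 + 2(ζ⁴ + ζ¹⁶))`: the integer Hankel matrix `(−Tr(ζ′sθ^{i+j}))ᵢⱼ` (and `b = 0`, part 82 `hb_eq_zero`).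
research route conditional on HC_CM; not a corollary; Q11.4-sentence-2 already refuted in dim ≥ 3. [cite: vanGeemen1994HodgeAV, Lemma 5.2 (2)–(3)] -/
theorem realPart_xi_sqrtNegFive [IsCyclotomicExtension {20} ℚ K] [IsCMField K] (hζ : IsPrimitiveRoot ζ 20)
    {x : Fin 4 → K} (hx : ∀ i, x i = (ζ + ζ⁻¹) ^ (i : ℕ)) {a : Matrix (Fin 4) (Fin 4) ℚ}
    (ha : ∀ i j, a i j = Algebra.trace ℚ K ((ζ ^ 3 * (aeval ζ (derivative (cyclotomic 20 ℚ)))⁻¹) * x i * IsCMField.complexConj K ((ζ ^ 5 * (1 + 2 * (ζ ^ 4 + ζ ^ 16))) * x j))) :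
    a = !![0, -2, 0, -10; -2, 0, -10, 0; 0, -10, 0, -40; -10, 0, -40, 0] := by
  rw [ha_eq (complexConj_sqrtNegFive hζ) (complexConj_thetaFrame hζ hx) ha]
  ext i j
  simp only [Matrix.of_apply, hx, ← pow_add]
  fin_cases i <;> fin_cases j <;> simp [trace_xi_sqrtNegFive_zero hζ, trace_xi_sqrtNegFive_one hζ, trace_xi_sqrtNegFive_two hζ, trace_xi_sqrtNegFive_three hζ, trace_xi_sqrtNegFive_four hζ, trace_xi_sqrtNegFive_five hζ, trace_xi_sqrtNegFive_six hζ]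

/-- **`det a = 400`** for `ζ′ = ξ = ζ³/Φ′(ζ)`, `s = √−5 = ζ⁵(1 + 2(ζ⁴ + ζ¹⁶))` (frame `θ^i`). research route conditional on HC_CM; not a corollary; Q11.4-sentence-2 already refuted in dim ≥ 3. [cite: vanGeemen1994HodgeAV, Lemma 5.2 (3)] -/
theorem det_realPart_xi_sqrtNegFive [IsCyclotomicExtension {20} ℚ K] [IsCMField K] (hζ : IsPrimitiveRoot ζ 20)
    {x : Fin 4 → K} (hx : ∀ i, x i = (ζ + ζ⁻¹) ^ (i : ℕ)) {a : Matrix (Fin 4) (Fin 4) ℚ}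
    (ha : ∀ i j, a i j = Algebra.trace ℚ K ((ζ ^ 3 * (aeval ζ (derivative (cyclotomic 20 ℚ)))⁻¹) * x i * IsCMField.complexConj K ((ζ ^ 5 * (1 + 2 * (ζ ^ 4 + ζ ^ 16))) * x j))) :
    a.det = 400 := by
  rw [realPart_xi_sqrtNegFive hζ hx ha]
  simp [Matrix.det_succ_row_zero, Fin.sum_univ_succ, Fin.succAbove, Matrix.submatrix]
  norm_num

/-! ### §2 Every principal-type parameter gives `400`; the class is SPLIT -/

/-- **For EVERY skew `ζ′` of PRINCIPAL type on `ℤ[ζ_20]` (`IsOfType 1 ζ′ ⊤`; `ζ′ = uξ`, `u` a real unit, `N(u) = 1`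
by THEOREM L (i) at `20`) the Gram determinant of `(E_ζ′, s₅)` in the frame `θ^i` is `400`** — for every `Φ` and
every `Φ`-positive such `ζ′` (they exist on every `s₅`-balanced `Φ`: the census YES row, part 75
`exists_principal_twenty_…`): the SPLIT row W4.5.1 `= (2, ℚ(√−5), 1)`; `(−1)² det a > 0`, the right sign for Weil signature `(2,2)` [vG94 5.2 (4)].
research route conditional on HC_CM; not a corollary; Q11.4-sentence-2 already refuted in dim ≥ 3. [cite: vanGeemen1994HodgeAV, Lemma 5.2 (3)–(4) and (5.4.1)] [cite: Shimura1998, §14.3 Prop. 5, p. 104] -/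
theorem det_realPart_principal_sqrtNegFive [IsCyclotomicExtension {20} ℚ K] [IsCMField K]
    (hζ : IsPrimitiveRoot ζ 20) {ζ' : K} (hζ' : IsCMField.complexConj K ζ' = -ζ')
    (hT : CMTypeLattice.IsOfType (1 : (FractionalIdeal (𝓞 K)⁰ K)ˣ) ζ' ⊤)
    {x : Fin 4 → K} (hx : ∀ i, x i = (ζ + ζ⁻¹) ^ (i : ℕ)) {a : Matrix (Fin 4) (Fin 4) ℚ}
    (ha : ∀ i j, a i j = Algebra.trace ℚ K (ζ' * x i * IsCMField.complexConj K ((ζ ^ 5 * (1 + 2 * (ζ ^ 4 + ζ ^ 16))) * x j))) :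
    a.det = 400 := by
  obtain ⟨ωb, hωb⟩ := exists_basis_thetaPow hζ
  have hx' : ∀ i, x i = (ωb i : K) := fun i => (hx i).trans (hωb i).symm
  rw [det_realPart_eq_of_isOfType ωb (complexConj_sqrtNegFive hζ) hx' (norm_realUnits_pos_twenty hζ)
    (complexConj_xi_twenty hζ) (xi_ne_zero hζ 3) hζ' (isOfType_one_xi_top hζ 3) hT (fun i j => rfl) ha]
  exact det_realPart_xi_sqrtNegFive hζ hx (fun i j => rfl)

/-- **`[400] = [1]`, the SPLIT class, in `ℚˣ/Nm(ℚ(√−5)ˣ)`** (`400 = 20² + 5·0²`): the principally polarised Weil-type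
`ℤ[ζ_20]`-fourfolds for `ℚ(√−5)` lie on the SPLIT component — the SPLIT row W4.5.1 `= (2, ℚ(√−5), 1)` (the census's (F3) «`𝒪_K`-linear + principal ⟹
split» for these CM points, as a kernel theorem).
research route conditional on HC_CM; not a corollary; Q11.4-sentence-2 already refuted in dim ≥ 3. [cite: vanGeemen1994HodgeAV, 5.4 and (5.4.1)] -/
theorem mk0_det_principal_sqrtNegFive :
    (QuotientGroup.mk (Units.mk0 (400 : ℚ) (by norm_num)) : weilNormResidueGroup 5) = splitDiscriminantClass 2 5 :=
  mk_eq_split_of_even (by decide) _ (mem_normUnitsSubgroup_of_sq_add_mul_sq _ (20 : ℚ) (0 : ℚ) (by norm_num))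

end Summit.HodgeConjecture.Ring2WeilCoverage.WeilGramLevel20SqrtNegFive

end
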